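import Mathlib
import Summits.Ventures.PercRepro2.Defs
import Summits.Ventures.PercRepro2.Harris
import Summits.Ventures.PercRepro2.Graph
import Summits.Ventures.PercRepro2.Events
import Summits.Ventures.PercRepro2.BHKAvoidWeighted
import Summits.Ventures.PercRepro2.PsiPendantLemmas
import Summits.Ventures.PercRepro2.PsiUniSure
import Summits.Ventures.PercRepro2.PsiUniExplored
import Summits.Ventures.PercRepro2.PsiBernstein
import Summits.Ventures.PercRepro2.PsiTEdge
import Summits.Ventures.PercRepro2.PsiBernTMark

/-!
# (BERN_f) at the explored `t`-component when the mark is the conditioning vertex (PercRepro2, p2)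

Let `f` with `ends f = s(t', y)` be the only unpinned edge at the explored `t`-component `Λ` of `p`
(`t' ∈ Λ`; `s, u ∉ Λ`), let the mark `o` be the conditioning vertex `u`, and let every member of `𝓤`
contain `u`.  Then `{o ∈ C_s} = {s ↔ u}`, `{o ∈ C_t} ∩ {u ∈ C_s}` is impossible on `Q`, and the two
worlds of `PsiTEdge.lean` give the masses; the mixed Bernstein coefficients collapse to
`T₁ = Su(1 − Su)·UgN + Ug·(Su·(q¹ − aH¹) + (1 − Su)·aH¹ + (1 − Su)·oL¹)` and
`T₂ = Ug·(q¹ − aH¹)(oL¹ + aH¹) + UgN·((oL¹ + aH¹)(1 − Su) + Su·(q¹ − aH¹))`, nonnegative by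
monotonicity alone (`aH¹ ≤ q¹`, `Su ≤ 1`) — P2-G18-BERN.md §7b (iii).

* `tmarkou_*_one` — the open-world masses in closed-world terms;
* `psi_bern_t_of_mark_ou` — **`0 ≤ T₁` and `0 ≤ T₂` when the mark is the conditioning vertex**.
-/

namespace Summit.Ventures.PercRepro2

section TMarkOU

variable {V : Type*} {E : Type*} [Fintype E] [DecidableEq E]
  {R : Type*} [CommRing R] [LinearOrder R] [IsStrictOrderedRing R]

omit [IsStrictOrderedRing R] in
/-- With `f = (t', y)` open, `Q` is `{s ↮ y}` of the closed world. -/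
lemma tmarkou_q_one (p : E → R) (ends : E → Sym2 V) (s t t' y : V) (f : E)
    (hf : ends f = s(t', y)) (ht' : Conn ends (fun e => decide (p e = 1)) t t')
    (hs : ¬ Conn ends (fun e => decide (p e = 1)) t s) (hpf1 : p f ≠ 1)
    (hpin : ∀ e, e ≠ f → (∃ v ∈ ends e, Conn ends (fun e => decide (p e = 1)) t v) →
      p e = 0 ∨ p e = 1) :
    prob (Function.update p f 1) (connEvent ends s t)ᶜ =
      prob (Function.update p f 0) (connEvent ends s y)ᶜ := by
  refine prob_update_one_eq_prob_update_zero_of_respects p f fun ω h0 h1 => ?_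
  simp only [Set.mem_compl_iff, mem_connEvent]
  exact not_congr (conn_update_true_s_t_iff hf ht' hs hpf1 hpin h0 h1)

omit [IsStrictOrderedRing R] in
/-- With `f = (t', y)` open and `u` off the explored component, `{u ∈ C_t} ∩ Q` is
`{y ↔ u, s ↮ y}` of the closed world. -/
lemma tmarkou_oL_one (p : E → R) (ends : E → Sym2 V) (s t t' y u : V) (f : E)
    (hf : ends f = s(t', y)) (ht' : Conn ends (fun e => decide (p e = 1)) t t')
    (hs : ¬ Conn ends (fun e => decide (p e = 1)) t s) (hpf1 : p f ≠ 1)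
    (hpin : ∀ e, e ≠ f → (∃ v ∈ ends e, Conn ends (fun e => decide (p e = 1)) t v) →
      p e = 0 ∨ p e = 1) (hu : ¬ Conn ends (fun e => decide (p e = 1)) t u) :
    prob (Function.update p f 1) (clusterInEvent ends t {W : Set V | u ∈ W} ∩
      (connEvent ends s t)ᶜ) =
      prob (Function.update p f 0) (connEvent ends y u ∩ (connEvent ends s y)ᶜ) := by
  refine prob_update_one_eq_prob_update_zero_of_respects p f fun ω h0 h1 => ?_
  simp only [Set.mem_inter_iff, mem_clusterInEvent, Set.mem_setOf_eq, mem_cluster,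
    Set.mem_compl_iff, mem_connEvent]
  constructor
  · rintro ⟨htu, hst⟩
    rcases (conn_update_true_t_iff hf ht' hpf1 hpin h0 h1 u).1 htu with h | h
    · exact absurd h hu
    · exact ⟨h, (not_congr (conn_update_true_s_t_iff hf ht' hs hpf1 hpin h0 h1)).1 hst⟩
  · rintro ⟨hyu, hsy⟩
    exact ⟨(conn_update_true_t_iff hf ht' hpf1 hpin h0 h1 u).2 (Or.inr hyu), (not_congr (conn_update_true_s_t_iff hf ht' hs hpf1 hpin h0 h1)).2 hsy⟩

omit [IsStrictOrderedRing R] in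
/-- With `f = (t', y)` open, `{s ↔ u} ∩ Q` is `{s ↔ u, s ↮ y}` of the closed world. -/
lemma tmarkou_aH_one (p : E → R) (ends : E → Sym2 V) (s t t' y u : V) (f : E)
    (hf : ends f = s(t', y)) (ht' : Conn ends (fun e => decide (p e = 1)) t t')
    (hs : ¬ Conn ends (fun e => decide (p e = 1)) t s) (hpf1 : p f ≠ 1)
    (hpin : ∀ e, e ≠ f → (∃ v ∈ ends e, Conn ends (fun e => decide (p e = 1)) t v) →
      p e = 0 ∨ p e = 1) :
    prob (Function.update p f 1) (connEvent ends s u ∩ (connEvent ends s t)ᶜ) =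
      prob (Function.update p f 0) (connEvent ends s u ∩ (connEvent ends s y)ᶜ) := by
  refine prob_update_one_eq_prob_update_zero_of_respects p f fun ω h0 h1 => ?_
  simp only [Set.mem_inter_iff, Set.mem_compl_iff, mem_connEvent]
  constructor
  · rintro ⟨hsu, hst⟩
    exact ⟨(conn_update_true_s_iff_of_not_conn hf ht' hs hpf1 hpin h0 h1 hst u).1 hsu, fun h => hst ((conn_update_true_s_t_iff hf ht' hs hpf1 hpin h0 h1).2 h)⟩
  · rintro ⟨hsu, hsy⟩
    have hst : ¬ Conn ends (Function.update ω f true) s t := fun h => hsy ((conn_update_true_s_t_iff hf ht' hs hpf1 hpin h0 h1).1 h)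
    exact ⟨(conn_update_true_s_iff_of_not_conn hf ht' hs hpf1 hpin h0 h1 hst u).2 hsu, hst⟩

omit [LinearOrder R] [IsStrictOrderedRing R] in
/-- With `f = (t', y)` open, `{u ∈ C_s} ∩ {u ∈ C_t} ∩ Q` is null. -/
lemma tmarkou_oLH_one (p : E → R) (ends : E → Sym2 V) (s t u : V) (f : E) :
    prob (Function.update p f 1) (connEvent ends s u ∩ clusterInEvent ends t {W : Set V | u ∈ W} ∩
      (connEvent ends s t)ᶜ) = 0 := by
  rw [prob_update_one_eq_prob_update_zero_of_respects p f (A' := (∅ : Set (Config E)))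
    fun ω h0 h1 => ?_]
  · exact prob_empty _
  simp only [Set.mem_inter_iff, mem_clusterInEvent, Set.mem_setOf_eq, mem_cluster,
    Set.mem_compl_iff, mem_connEvent, Set.mem_empty_iff_false, iff_false, not_and, not_not]
  rintro ⟨hsu, htu⟩
  exact conn_trans hsu (conn_symm htu)

omit [IsStrictOrderedRing R] in
/-- With `f = (t', y)` open, `{C_s ∈ 𝓤} ∩ Q` is `{C_s ∈ 𝓤, s ↮ y}` of the closed world. -/
lemma tmarkou_Ug_one (p : E → R) (ends : E → Sym2 V) (s t t' y : V) (f : E)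
    (hf : ends f = s(t', y)) (ht' : Conn ends (fun e => decide (p e = 1)) t t')
    (hs : ¬ Conn ends (fun e => decide (p e = 1)) t s) (hpf1 : p f ≠ 1)
    (hpin : ∀ e, e ≠ f → (∃ v ∈ ends e, Conn ends (fun e => decide (p e = 1)) t v) →
      p e = 0 ∨ p e = 1) (𝓤 : Set (Set V)) :
    prob (Function.update p f 1) (clusterInEvent ends s 𝓤 ∩ (connEvent ends s t)ᶜ) =
      prob (Function.update p f 0) (clusterInEvent ends s 𝓤 ∩ (connEvent ends s y)ᶜ) := by
  refine prob_update_one_eq_prob_update_zero_of_respects p f fun ω h0 h1 => ?_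
  simp only [Set.mem_inter_iff, mem_clusterInEvent, Set.mem_compl_iff, mem_connEvent]
  constructor
  · rintro ⟨hU, hst⟩
    have hc : cluster ends (Function.update ω f true) s = cluster ends (Function.update ω f false) s := by
      ext x
      simp only [mem_cluster]
      exact conn_update_true_s_iff_of_not_conn hf ht' hs hpf1 hpin h0 h1 hst x
    exact ⟨hc ▸ hU, fun h => hst ((conn_update_true_s_t_iff hf ht' hs hpf1 hpin h0 h1).2 h)⟩
  · rintro ⟨hU, hsy⟩
    have hst : ¬ Conn ends (Function.update ω f true) s t := fun h => hsy ((conn_update_true_s_t_iff hf ht' hs hpf1 hpin h0 h1).1 h)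
    have hc : cluster ends (Function.update ω f true) s = cluster ends (Function.update ω f false) s := by
      ext x
      simp only [mem_cluster]
      exact conn_update_true_s_iff_of_not_conn hf ht' hs hpf1 hpin h0 h1 hst x
    exact ⟨hc ▸ hU, hst⟩

omit [LinearOrder R] [IsStrictOrderedRing R] in
/-- With `f = (t', y)` open and every member of `𝓤` containing `u`, `{C_s ∈ 𝓤} ∩ {u ∈ C_t} ∩ Q`
is null. -/
lemma tmarkou_oLU_one (p : E → R) (ends : E → Sym2 V) (s t u : V) (f : E) {𝓤 : Set (Set V)} (hU : ∀ W ∈ 𝓤, u ∈ W) :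
    prob (Function.update p f 1) (clusterInEvent ends s 𝓤 ∩ clusterInEvent ends t {W : Set V | u ∈ W} ∩
      (connEvent ends s t)ᶜ) = 0 := by
  rw [prob_update_one_eq_prob_update_zero_of_respects p f (A' := (∅ : Set (Config E)))
    fun ω h0 h1 => ?_]
  · exact prob_empty _
  simp only [Set.mem_inter_iff, mem_clusterInEvent, Set.mem_setOf_eq, mem_cluster,
    Set.mem_compl_iff, mem_connEvent, Set.mem_empty_iff_false, iff_false, not_and, not_not]
  rintro ⟨hUU, htu⟩
  exact conn_trans (mem_cluster.1 (hU _ hUU)) (conn_symm htu)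

/-- **(BERN_f) at the explored `t`-component when the mark is the conditioning vertex.** With
`f = (t', y)` the only unpinned edge at the explored component (`t' ∈ Λ`, `s, u ∉ Λ`), the mark
`o = u`, and every member of `𝓤` containing `u`, the two mixed Bernstein coefficients of the
(Ψ)-slack along `f` are nonnegative (monotonicity alone). -/
theorem psi_bern_t_of_mark_ou (p : E → R) (hp : IsProbVec p) (ends : E → Sym2 V) (s t t' y u : V) (f : E)
    (hf : ends f = s(t', y)) (ht' : Conn ends (fun e => decide (p e = 1)) t t')
    (hs : ¬ Conn ends (fun e => decide (p e = 1)) t s)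
    (hu : ¬ Conn ends (fun e => decide (p e = 1)) t u) (hpf1 : p f ≠ 1)
    (hpin : ∀ e, e ≠ f → (∃ v ∈ ends e, Conn ends (fun e => decide (p e = 1)) t v) →
      p e = 0 ∨ p e = 1) {𝓤 : Set (Set V)} (hU : ∀ W ∈ 𝓤, u ∈ W) :
    0 ≤ (((prob (Function.update p f 0) (connEvent ends s t)ᶜ - prob (Function.update p f 0) (connEvent ends s u ∩ (connEvent ends s t)ᶜ)) * prob (Function.update p f 0) (clusterInEvent ends t {W : Set V | u ∈ W} ∩ (connEvent ends s t)ᶜ) +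
          prob (Function.update p f 0) (connEvent ends s t)ᶜ * (prob (Function.update p f 0) (connEvent ends s u ∩ clusterInEvent ends t {W : Set V | u ∈ W} ∩
          (connEvent ends s t)ᶜ) + prob (Function.update p f 0) (connEvent ends s u ∩ clusterInEvent ends s {W : Set V | u ∈ W} ∩
          (connEvent ends s t)ᶜ)) -
          prob (Function.update p f 0) (connEvent ends s u ∩ (connEvent ends s t)ᶜ) * prob (Function.update p f 0) (clusterInEvent ends s {W : Set V | u ∈ W} ∩ (connEvent ends s t)ᶜ)) * prob (Function.update p f 1) (clusterInEvent ends s 𝓤 ∩ (connEvent ends s t)ᶜ) +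
        (prob (Function.update p f 0) (clusterInEvent ends s 𝓤 ∩ (connEvent ends s t)ᶜ) * (prob (Function.update p f 0) (clusterInEvent ends t {W : Set V | u ∈ W} ∩ (connEvent ends s t)ᶜ) + prob (Function.update p f 0) (connEvent ends s u ∩ clusterInEvent ends t {W : Set V | u ∈ W} ∩
          (connEvent ends s t)ᶜ) + prob (Function.update p f 0) (connEvent ends s u ∩ clusterInEvent ends s {W : Set V | u ∈ W} ∩
          (connEvent ends s t)ᶜ)) -
          2 * prob (Function.update p f 0) (clusterInEvent ends s 𝓤 ∩ clusterInEvent ends t {W : Set V | u ∈ W} ∩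
          (connEvent ends s t)ᶜ) * prob (Function.update p f 0) (connEvent ends s t)ᶜ) * prob (Function.update p f 1) (connEvent ends s t)ᶜ +
        prob (Function.update p f 0) (clusterInEvent ends s 𝓤 ∩ (connEvent ends s t)ᶜ) * (prob (Function.update p f 0) (connEvent ends s t)ᶜ - prob (Function.update p f 0) (connEvent ends s u ∩ (connEvent ends s t)ᶜ)) * prob (Function.update p f 1) (clusterInEvent ends t {W : Set V | u ∈ W} ∩ (connEvent ends s t)ᶜ) -
        prob (Function.update p f 0) (clusterInEvent ends s 𝓤 ∩ (connEvent ends s t)ᶜ) * (prob (Function.update p f 0) (clusterInEvent ends t {W : Set V | u ∈ W} ∩ (connEvent ends s t)ᶜ) + prob (Function.update p f 0) (clusterInEvent ends s {W : Set V | u ∈ W} ∩ (connEvent ends s t)ᶜ)) * prob (Function.update p f 1) (connEvent ends s u ∩ (connEvent ends s t)ᶜ) +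
        prob (Function.update p f 0) (clusterInEvent ends s 𝓤 ∩ (connEvent ends s t)ᶜ) * prob (Function.update p f 0) (connEvent ends s t)ᶜ * (prob (Function.update p f 1) (connEvent ends s u ∩ clusterInEvent ends t {W : Set V | u ∈ W} ∩
          (connEvent ends s t)ᶜ) + prob (Function.update p f 1) (connEvent ends s u ∩ clusterInEvent ends s {W : Set V | u ∈ W} ∩
          (connEvent ends s t)ᶜ)) -
        prob (Function.update p f 0) (clusterInEvent ends s 𝓤 ∩ (connEvent ends s t)ᶜ) * prob (Function.update p f 0) (connEvent ends s u ∩ (connEvent ends s t)ᶜ) * prob (Function.update p f 1) (clusterInEvent ends s {W : Set V | u ∈ W} ∩ (connEvent ends s t)ᶜ) -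
        prob (Function.update p f 0) (connEvent ends s t)ᶜ * prob (Function.update p f 0) (connEvent ends s t)ᶜ * prob (Function.update p f 1) (clusterInEvent ends s 𝓤 ∩ clusterInEvent ends t {W : Set V | u ∈ W} ∩
          (connEvent ends s t)ᶜ)) ∧
    0 ≤ (((prob (Function.update p f 1) (connEvent ends s t)ᶜ - prob (Function.update p f 1) (connEvent ends s u ∩ (connEvent ends s t)ᶜ)) * prob (Function.update p f 1) (clusterInEvent ends t {W : Set V | u ∈ W} ∩ (connEvent ends s t)ᶜ) +
          prob (Function.update p f 1) (connEvent ends s t)ᶜ * (prob (Function.update p f 1) (connEvent ends s u ∩ clusterInEvent ends t {W : Set V | u ∈ W} ∩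
          (connEvent ends s t)ᶜ) + prob (Function.update p f 1) (connEvent ends s u ∩ clusterInEvent ends s {W : Set V | u ∈ W} ∩
          (connEvent ends s t)ᶜ)) -
          prob (Function.update p f 1) (connEvent ends s u ∩ (connEvent ends s t)ᶜ) * prob (Function.update p f 1) (clusterInEvent ends s {W : Set V | u ∈ W} ∩ (connEvent ends s t)ᶜ)) * prob (Function.update p f 0) (clusterInEvent ends s 𝓤 ∩ (connEvent ends s t)ᶜ) +
        (prob (Function.update p f 1) (clusterInEvent ends s 𝓤 ∩ (connEvent ends s t)ᶜ) * (prob (Function.update p f 1) (clusterInEvent ends t {W : Set V | u ∈ W} ∩ (connEvent ends s t)ᶜ) + prob (Function.update p f 1) (connEvent ends s u ∩ clusterInEvent ends t {W : Set V | u ∈ W} ∩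
          (connEvent ends s t)ᶜ) + prob (Function.update p f 1) (connEvent ends s u ∩ clusterInEvent ends s {W : Set V | u ∈ W} ∩
          (connEvent ends s t)ᶜ)) -
          2 * prob (Function.update p f 1) (clusterInEvent ends s 𝓤 ∩ clusterInEvent ends t {W : Set V | u ∈ W} ∩
          (connEvent ends s t)ᶜ) * prob (Function.update p f 1) (connEvent ends s t)ᶜ) * prob (Function.update p f 0) (connEvent ends s t)ᶜ +
        prob (Function.update p f 1) (clusterInEvent ends s 𝓤 ∩ (connEvent ends s t)ᶜ) * (prob (Function.update p f 1) (connEvent ends s t)ᶜ - prob (Function.update p f 1) (connEvent ends s u ∩ (connEvent ends s t)ᶜ)) * prob (Function.update p f 0) (clusterInEvent ends t {W : Set V | u ∈ W} ∩ (connEvent ends s t)ᶜ) -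
        prob (Function.update p f 1) (clusterInEvent ends s 𝓤 ∩ (connEvent ends s t)ᶜ) * (prob (Function.update p f 1) (clusterInEvent ends t {W : Set V | u ∈ W} ∩ (connEvent ends s t)ᶜ) + prob (Function.update p f 1) (clusterInEvent ends s {W : Set V | u ∈ W} ∩ (connEvent ends s t)ᶜ)) * prob (Function.update p f 0) (connEvent ends s u ∩ (connEvent ends s t)ᶜ) +
        prob (Function.update p f 1) (clusterInEvent ends s 𝓤 ∩ (connEvent ends s t)ᶜ) * prob (Function.update p f 1) (connEvent ends s t)ᶜ * (prob (Function.update p f 0) (connEvent ends s u ∩ clusterInEvent ends t {W : Set V | u ∈ W} ∩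
          (connEvent ends s t)ᶜ) + prob (Function.update p f 0) (connEvent ends s u ∩ clusterInEvent ends s {W : Set V | u ∈ W} ∩
          (connEvent ends s t)ᶜ)) -
        prob (Function.update p f 1) (clusterInEvent ends s 𝓤 ∩ (connEvent ends s t)ᶜ) * prob (Function.update p f 1) (connEvent ends s u ∩ (connEvent ends s t)ᶜ) * prob (Function.update p f 0) (clusterInEvent ends s {W : Set V | u ∈ W} ∩ (connEvent ends s t)ᶜ) -
        prob (Function.update p f 1) (connEvent ends s t)ᶜ * prob (Function.update p f 1) (connEvent ends s t)ᶜ * prob (Function.update p f 0) (clusterInEvent ends s 𝓤 ∩ clusterInEvent ends t {W : Set V | u ∈ W} ∩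
          (connEvent ends s t)ᶜ)) := by
  have hp0 : IsProbVec (Function.update p f 0) := hp.update f le_rfl zero_le_one
  have hω := tmark_pinned_eq p f hpf1
  have hpin0 : ∀ e, (∃ v ∈ ends e, Conn ends (fun e => decide (Function.update p f 0 e = 1)) t v) →
      Function.update p f 0 e = 0 ∨ Function.update p f 0 e = 1 := by
    intro e he
    rw [hω] at he
    by_cases hef : e = f
    · subst hef
      exact Or.inl (by simp)
    · rw [Function.update_of_ne hef]
      exact hpin e hef he
  have hQ0 : prob (Function.update p f 0) (connEvent ends s t) = 0 := by
    rw [connEvent_comm]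
    exact prob_connEvent_eq_zero_of_explored _ ends hpin0 (by rw [hω]; exact hs)
  have hu0 : prob (Function.update p f 0) (connEvent ends t u) = 0 :=
    prob_connEvent_eq_zero_of_explored _ ends hpin0 (by rw [hω]; exact hu)
  have hq0 : prob (Function.update p f 0) (connEvent ends s t)ᶜ = 1 := by
    rw [prob_compl, hQ0, sub_zero]
  have hoL0 : prob (Function.update p f 0) (clusterInEvent ends t {W : Set V | u ∈ W}) = 0 := by
    rw [clusterInEvent_memFamily_eq_connEvent]; exact hu0
  have hset : clusterInEvent ends s {W : Set V | u ∈ W} = connEvent ends s u :=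
    clusterInEvent_memFamily_eq_connEvent ends s u
  -- the open world
  have e1 := tmarkou_q_one p ends s t t' y f hf ht' hs hpf1 hpin
  have e2 := tmarkou_oL_one p ends s t t' y u f hf ht' hs hpf1 hpin hu
  have e4 := tmarkou_aH_one p ends s t t' y u f hf ht' hs hpf1 hpin
  have e3 : prob (Function.update p f 1) (clusterInEvent ends s {W : Set V | u ∈ W} ∩
      (connEvent ends s t)ᶜ) =
      prob (Function.update p f 0) (connEvent ends s u ∩ (connEvent ends s y)ᶜ) := by
    rw [hset]; exact e4
  have e5 := tmarkou_oLH_one p ends s t u f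
  have e6 : prob (Function.update p f 1) (connEvent ends s u ∩
      clusterInEvent ends s {W : Set V | u ∈ W} ∩ (connEvent ends s t)ᶜ) =
      prob (Function.update p f 0) (connEvent ends s u ∩ (connEvent ends s y)ᶜ) := by
    rw [hset, Set.inter_self]; exact e4
  have e7 := tmarkou_Ug_one p ends s t t' y f hf ht' hs hpf1 hpin 𝓤
  have e8 := tmarkou_oLU_one p ends s t u f hU
  rw [e1, e2, e3, e4, e5, e6, e7, e8, hq0]
  simp only [prob_inter_compl_of_eq_zero hp0 hQ0]
  rw [prob_inter_eq_zero_of_right hp0 hoL0, prob_inter_eq_zero_of_right hp0 hoL0, hoL0, hset,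
    Set.inter_self]
  -- monotonicity and bounds in the closed world
  have hmono : prob (Function.update p f 0) (connEvent ends s u ∩ (connEvent ends s y)ᶜ) ≤
      prob (Function.update p f 0) (connEvent ends s y)ᶜ := prob_mono hp0 Set.inter_subset_right
  have hSu1 : prob (Function.update p f 0) (connEvent ends s u) ≤ 1 := prob_le_one hp0 _
  have hSu : 0 ≤ prob (Function.update p f 0) (connEvent ends s u) := prob_nonneg hp0 _
  have hUg : 0 ≤ prob (Function.update p f 0) (clusterInEvent ends s 𝓤) := prob_nonneg hp0 _
  have hUgN : 0 ≤ prob (Function.update p f 0) (clusterInEvent ends s 𝓤 ∩ (connEvent ends s y)ᶜ) :=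
    prob_nonneg hp0 _
  have hoL1 : 0 ≤ prob (Function.update p f 0) (connEvent ends y u ∩ (connEvent ends s y)ᶜ) :=
    prob_nonneg hp0 _
  have haH1 : 0 ≤ prob (Function.update p f 0) (connEvent ends s u ∩ (connEvent ends s y)ᶜ) :=
    prob_nonneg hp0 _
  have k1 := mul_nonneg (mul_nonneg hSu (sub_nonneg.2 hSu1)) hUgN
  have k2 := mul_nonneg hUg (mul_nonneg hSu (sub_nonneg.2 hmono))
  have k3 := mul_nonneg hUg (mul_nonneg (sub_nonneg.2 hSu1) haH1)
  have k4 := mul_nonneg hUg (mul_nonneg (sub_nonneg.2 hSu1) hoL1)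
  have k5 := mul_nonneg hUg (mul_nonneg (sub_nonneg.2 hmono) (add_nonneg hoL1 haH1))
  have k6 := mul_nonneg hUgN (mul_nonneg (add_nonneg hoL1 haH1) (sub_nonneg.2 hSu1))
  have k7 := mul_nonneg hUgN (mul_nonneg hSu (sub_nonneg.2 hmono))
  constructor
  · nlinarith [k1, k2, k3, k4]
  · nlinarith [k5, k6, k7]

end TMarkOU

end Summit.Ventures.PercRepro2
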